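import Summits.QuantumFields.YangMills.Theorems.BalabanUVNodesN15TwoGridEntry1Core
import Summits.QuantumFields.YangMills.Theorems.BalabanUVNodesN15TwoGridHolderSteps
import Summits.QuantumFields.YangMills.Theorems.BalabanUVNodesN15TwoGridLandauEntry0Full
import HarnessLib

/-!
# Route «BalabanUVNodes», node N15 = NE2, -a lane, part 59: ★★★ ENTRY 1 OF [B9] (3.42) FOR BAŁABAN's FULL LANDAU-GAUGE PAIR `(G′, G)` AT `U ≡ 1` —
# `𝔇(∇_νG) = ∇′_νG′P − P∇_νG` HAS THE BLOCK MAJORANT `C·(L^k)^{−1∕16}·e^{−δ|y−y′|_T}`, HYPOTHESIS-FREE (interpolation route; no Hölder-source currency)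

Cell `pub-ymgap`, seat `pub-ymgap-dag-n15-a` (KNIT-BY-NAME, g13); `--kind proof --supports stmt-QuantumFields-20507 --as helper`.  Over part 58 (`hasMaj_entry1_core`), part 52
(`hasMaj_twoGridDefect`, entry 0 at `γ = ½`), part 44 (`hasMaj_outputSwap`), part 56 (`hasMaj_holderSteps_pair` at `α = ½`), part 57 (`hasMaj_inv_smul_gradStep`, `hasMaj_gradOutputSwap` at
`α = ½`), part 42 (`ineq110_114_pair`, `hasMaj_grad_of_ineq` for the a-priori bound).
WHAT.  §75 `hasMaj_rate_mono`; the rate bookkeeping `pow_mul_rpow_le_of_le` (`x^t(x^k)^{−1∕4} ≤ (x^k)^{−1∕8}`, `8t ≤ k`), `inv_pow_rpow_half_le` (`(x^{−t})^{1∕2} ≤ x·(x^k)^{−1∕16}`,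
`k ≤ 8t+7`); `hasMaj_entry1_apriori` (`2Ce^{δ₀}`, (1.110) «∇GJ» on both members, no rate); ★★★ **`hasMaj_twoGridDefect_grad`**: for odd `L ≥ 3`, `a > 0`:
`∃ δ C > 0 ∀ m_T, k ≥ 1, m, ν`, `HasMaj (ofBlocks … blkFine) (ofBlocks … blockOf_{L^m·L^k}) (idef P P (ρ′(n′(s_ν−1))∘G′) (ρ(n(s_ν−1))∘G)) (C·(L^k)^{−1∕16}·e^{−δ|y−y′|_T})` —
`k ≥ 16`: part 58 at the common rate `δ = min` of the six inputs with `r = L^m·L^{k−⌊k∕8⌋}` (`n′∕r = L^t`, `r∕n′ = L^{−t}`, `t = ⌊k∕8⌋ ≥ 2 ⇒ 4r ≤ n′`); `k < 16`: the a-priori bound and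
`L·(L^k)^{−1∕16} ≥ 1`.  This is the honest `T1` of part 55's readout `ne2ZeroOperator_fullG_of_entries12` (sequel: the readout modulo entry 2 only).
HONEST FRAMING ∕ LIMITS.  `U ≡ 1` torus family of record (`M_μ = 2L^{m_T}`); every analytic input is a tree theorem (Bałaban's (1.110)∕(1.111)∕(1.126) and King's (3.71) enter ONLY through
parts 39–58); the exponent `1∕16` is what this bookkeeping gives (not optimised); ENTRY 2 `𝔇(G∇*)` NOT here (no sup-only route: the derivative sits on the ROUGH source; located TRUE route =
an L²-block `BlockNorm` + (1.114) + L² duality `Pᵀ = Q_m`); count-neutral (typed 28∕28 · discharged 5∕27 of record unchanged); NOT a discharge of N15 (object-bound: the node's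
`NE2PlusOperator` reads Node 00's [B9] operator letters; NE2⁺ NOT PRINTED); one finite T⁴ at fixed ε — NOT infinite volume, NOT OS on ℝ⁴, NOT a mass gap, NOT Clay.
-/

noncomputable section

open scoped BigOperators
open Finset

namespace Summit.QuantumFields.YangMills.BalabanUVNodes.N15.TwoGrid

open Literature.MathematicalPhysics.QuantumFieldTheory.Balaban1983to89
open Literature.MathematicalPhysics.QuantumFieldTheory.Balaban1983to89.B11SectG (BlockNorm HasMaj hasMaj_zero)
open Literature.MathematicalPhysics.QuantumFieldTheory.Balaban1983to89.T4EtaRateDefect (idef idef_apply)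
open Literature.MathematicalPhysics.QuantumFieldTheory.Balaban1983to89.T4EtaRateCoeffDefect (pull pull_apply)
open Literature.MathematicalPhysics.QuantumFieldTheory.Balaban1983to89.B5Prop11Plancherel (Tor fine unitVec)
open Literature.MathematicalPhysics.QuantumFieldTheory.Balaban1983to89.B5SiteBridgeP12 (MP)
open Literature.MathematicalPhysics.QuantumFieldTheory.Balaban1983to89.B5SettingP12Real (latticeSettingP12R)
open Literature.MathematicalPhysics.QuantumFieldTheory.King1986.Torus (blockOf tdistT tdistT_nonneg)
open Literature.MathematicalPhysics.QuantumFieldTheory.Balaban1983to89.B6UnitTorusCarrier (unitTorusGeo)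
open Summit.QuantumFields.YangMills.BalabanUVNodes.N15.VectorPiece (blkFine blkFine_apply kingPr kingPrV kingPrV_eq blkFine_comp_kingPrV)

variable {d : ℕ}

/-! ## §75 Rate bookkeeping and ★★★ the family theorem -/

section Family

variable {L : ℕ} [NeZero L]

omit [NeZero L] in
/-- rates only get worse (the lineage's `tdistT` form of `B11SectG.HasMaj.of_rate_le`). [folklore] -/
theorem hasMaj_rate_mono {M : Fin (d + 1) → ℕ} [∀ μ, NeZero (M μ)] {k : ℕ} {F₁ F₂ : Type} [AddCommGroup F₁] [Module ℝ F₁] [AddCommGroup F₂] [Module ℝ F₂]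
    {b₁ : BlockNorm (unitTorusGeo L k M) F₁} {b₂ : BlockNorm (unitTorusGeo L k M) F₂} {T : F₁ →ₗ[ℝ] F₂} {A ρ ρ' : ℝ} (hA : 0 ≤ A) (hρ : ρ ≤ ρ')
    (h : HasMaj b₁ b₂ T (fun y y' => A * Real.exp (-(ρ' * tdistT M y y')))) : HasMaj b₁ b₂ T (fun y y' => A * Real.exp (-(ρ * tdistT M y y'))) :=
  h.mono fun y y' => mul_le_mul_of_nonneg_left (Real.exp_le_exp.mpr (by nlinarith [tdistT_nonneg M y y'])) hA

/-- `x^t·(x^k)^{−1∕4} ≤ (x^k)^{−1∕8}` for `x ≥ 1`, `8t ≤ k`. [folklore] -/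
theorem pow_mul_rpow_le_of_le {x : ℝ} (hx : 1 ≤ x) {t k : ℕ} (h : 8 * t ≤ k) :
    x ^ t * (x ^ k) ^ (-(1 / 4 : ℝ)) ≤ (x ^ k) ^ (-(1 / 8 : ℝ)) := by
  have hx0 : 0 < x := by linarith
  have hxk : 0 < x ^ k := pow_pos hx0 k
  have h8 : (t : ℝ) ≤ (k : ℝ) * (1 / 8) := by
    have : ((8 * t : ℕ) : ℝ) ≤ (k : ℝ) := by exact_mod_cast h
    push_cast at this
    linarith
  have h1 : x ^ t ≤ (x ^ k) ^ (1 / 8 : ℝ) := by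
    rw [← Real.rpow_natCast x t, ← Real.rpow_natCast x k, ← Real.rpow_mul hx0.le]
    exact Real.rpow_le_rpow_of_exponent_le hx h8
  calc x ^ t * (x ^ k) ^ (-(1 / 4 : ℝ)) ≤ (x ^ k) ^ (1 / 8 : ℝ) * (x ^ k) ^ (-(1 / 4 : ℝ)) :=
        mul_le_mul_of_nonneg_right h1 (Real.rpow_nonneg hxk.le _)
    _ = (x ^ k) ^ (-(1 / 8 : ℝ)) := by rw [← Real.rpow_add hxk]; norm_num

/-- `((x^t)⁻¹)^{1∕2} ≤ x·(x^k)^{−1∕16}` for `x ≥ 1`, `k ≤ 8t + 7`. [folklore] -/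
theorem inv_pow_rpow_half_le {x : ℝ} (hx : 1 ≤ x) {t k : ℕ} (h : k ≤ 8 * t + 7) :
    ((x ^ t)⁻¹) ^ (1 / 2 : ℝ) ≤ x * (x ^ k) ^ (-(1 / 16 : ℝ)) := by
  have hx0 : 0 < x := by linarith
  have e1 : ((x ^ t)⁻¹) ^ (1 / 2 : ℝ) = x ^ (-(t : ℝ) * (1 / 2)) := by
    rw [← Real.rpow_natCast x t, ← Real.rpow_neg hx0.le, ← Real.rpow_mul hx0.le]
  have e2 : x * (x ^ k) ^ (-(1 / 16 : ℝ)) = x ^ (1 + (k : ℝ) * (-(1 / 16))) := by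
    rw [← Real.rpow_natCast x k, ← Real.rpow_mul hx0.le, Real.rpow_add hx0, Real.rpow_one]
  rw [e1, e2]
  refine Real.rpow_le_rpow_of_exponent_le hx ?_
  have : (k : ℝ) ≤ 8 * t + 7 := by exact_mod_cast h
  linarith

/-- **THE A-PRIORI BOUND**: `∇′_νG′P − P∇_νG` has the majorant `2C·e^{−δ₀d}` ((1.110) entry «∇GJ» on both members; no rate). [cite: Balaban1984PropagatorsI, Prop. 1.2 (1.110) p.35] -/
theorem hasMaj_entry1_apriori (M : Fin (d + 1) → ℕ) [∀ μ, NeZero (M μ)] (k m : ℕ) (a : ℝ) (ν : Fin (d + 1)) {K : ℕ} {K' : ℕ} {C δ₀ : ℝ}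
    {Cα Cε : ℝ → ℝ} {Cαε : ℝ → ℝ → ℝ} (hC : 0 ≤ C) (hδ₀ : 0 ≤ δ₀)
    (H1 : B5.Ineq110_114 (latticeSettingP12R (L ^ k) M a K) C Cα Cε Cαε δ₀) (H2 : B5.Ineq110_114 (latticeSettingP12R (L ^ m * L ^ k) M a K') C Cα Cε Cαε δ₀) :
    HasMaj (BlockNorm.ofBlocks (unitTorusGeo L k M) (blkFine L k M))
      (BlockNorm.ofBlocks (unitTorusGeo L k M) (fun i : Tor (fine (L ^ m * L ^ k) M) × Fin (d + 1) => blockOf (L ^ m * L ^ k) M i.1))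
      (idef (pull (kingPrV L k m M)) (pull (kingPrV L k m M))
        (symbOp M (L ^ m * L ^ k) (sD M (L ^ m * L ^ k) ν ((L ^ m * L ^ k : ℕ) : ℝ)) ∘ₗ gOp M (L ^ m * L ^ k) a)
        (symbOp M (L ^ k) (sD M (L ^ k) ν ((L ^ k : ℕ) : ℝ)) ∘ₗ gOp M (L ^ k) a))
      (fun y y' => 2 * C * Real.exp δ₀ * Real.exp (-(δ₀ * tdistT M y y'))) := by
  have hL0 : 0 < L := Nat.pos_of_ne_zero (NeZero.ne L)
  have hn1 : 1 ≤ L ^ k := Nat.one_le_pow _ _ hL0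
  have hn'1 : 1 ≤ L ^ m * L ^ k := Nat.one_le_iff_ne_zero.mpr (Nat.mul_ne_zero (pow_ne_zero m (NeZero.ne L)) (by positivity))
  have he1 : 1 ≤ Real.exp δ₀ := Real.one_le_exp hδ₀
  have hK0 : ∀ y y' : Tor M, 0 ≤ C * Real.exp (-(δ₀ * tdistT M y y')) := fun y y' => mul_nonneg hC (Real.exp_nonneg _)
  -- fine member through the prolongation on the source side
  have hf := hasMaj_comp_pull_kingPrV M k m hK0 (hasMaj_grad_of_ineq (L := L) (k := k) M (L ^ m * L ^ k) a hn'1 H2 hC ν)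
  -- coarse member through the prolongation on the output side
  have hc := hasMaj_pull_comp₂ (g := unitTorusGeo L k M) (b₁ := BlockNorm.ofBlocks (unitTorusGeo L k M) (blkFine L k M)) (blkFine L k M)
    (fun i : Tor (fine (L ^ m * L ^ k) M) × Fin (d + 1) => blockOf (L ^ m * L ^ k) M i.1) (kingPrV L k m M) hK0
    (fun x y' => by rw [show blkFine L k M (kingPrV L k m M x) = blockOf (L ^ m * L ^ k) M x.1 from congrFun (blkFine_comp_kingPrV M L k m) x])
    (hasMaj_grad_of_ineq (L := L) (k := k) M (L ^ k) a hn1 H1 hC ν)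
  rw [idef]
  refine ((hf.congr fun μ => rfl).sub hc).mono fun y y' => ?_
  have : C * Real.exp (-(δ₀ * tdistT M y y')) ≤ C * Real.exp δ₀ * Real.exp (-(δ₀ * tdistT M y y')) :=
    mul_le_mul_of_nonneg_right (le_mul_of_one_le_right hC he1) (Real.exp_nonneg _)
  linarith

/-- ★★★ **ENTRY 1 OF [B9] (3.42) FOR BAŁABAN's FULL LANDAU-GAUGE PAIR `(G′, G) = (Δ′_a⁻¹, Δ_a⁻¹)` AT `U ≡ 1`, HYPOTHESIS-FREE**: for odd `L ≥ 3` and `a > 0` there are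
`δ, C > 0` such that for EVERY torus exponent `m_T`, EVERY coarse scale `k ≥ 1`, EVERY refinement exponent `m` and every direction `ν`, the two-grid defect of the GRADIENT
`𝔇(∇_νG) = ∇′_νG′P − P∇_νG = idef P P (ρ′(n′(s_ν−1))∘G′) (ρ(n(s_ν−1))∘G)` (King's prolongation `P` on both sides, `n = L^k`, `n′ = L^m·L^k`) has the block majorant
`C·(L^k)^{−1∕16}·e^{−δ|y−y′|_T}` from coarse 1-forms localised in King's unit blocks to fine 1-forms observed on unit blocks — the honest `T1` of part 55's readout.
Proof = §74 at `α = γ = ½`, `r = L^m·L^{k−⌊k∕8⌋}` (`k ≥ 16`), the a-priori bound for `k < 16`; inputs parts 52, 44, 56, 57 (every analytic input a tree theorem).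
[cite: Balaban1985BackgroundPropagators, Thm 3.1 (3.42) p.397 (the entry ∇G); King1986, Prop. 3.9 (3.73) p.665 (η-rate shape, A = 0 model)] -/
theorem hasMaj_twoGridDefect_grad (hLodd : Odd L) (hL2 : 2 ≤ L) {a : ℝ} (ha : 0 < a) :
    ∃ δ C : ℝ, 0 < δ ∧ 0 < C ∧ ∀ (mT k m : ℕ) (hk : 1 ≤ k) (hL : Odd L ∧ 1 < L) (ν : Fin (d + 1)),
      HasMaj (BlockNorm.ofBlocks (unitTorusGeo L k (MP (paramsOf d L mT k hL))) (blkFine L k (MP (paramsOf d L mT k hL))))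
        (BlockNorm.ofBlocks (unitTorusGeo L k (MP (paramsOf d L mT k hL)))
          (fun i : Tor (fine (L ^ m * L ^ k) (MP (paramsOf d L mT k hL))) × Fin (d + 1) => blockOf (L ^ m * L ^ k) (MP (paramsOf d L mT k hL)) i.1))
        (idef (pull (kingPrV L k m (MP (paramsOf d L mT k hL)))) (pull (kingPrV L k m (MP (paramsOf d L mT k hL))))
          (symbOp (MP (paramsOf d L mT k hL)) (L ^ m * L ^ k) (sD (MP (paramsOf d L mT k hL)) (L ^ m * L ^ k) ν ((L ^ m * L ^ k : ℕ) : ℝ)) ∘ₗ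
            gOp (MP (paramsOf d L mT k hL)) (L ^ m * L ^ k) a)
          (symbOp (MP (paramsOf d L mT k hL)) (L ^ k) (sD (MP (paramsOf d L mT k hL)) (L ^ k) ν ((L ^ k : ℕ) : ℝ)) ∘ₗ gOp (MP (paramsOf d L mT k hL)) (L ^ k) a))
        (fun y y' => C * ((L ^ k : ℕ) : ℝ) ^ (-(1 / 16 : ℝ)) * Real.exp (-(δ * tdistT (MP (paramsOf d L mT k hL)) y y'))) := by
  have hL : Odd L ∧ 1 < L := ⟨hLodd, by omega⟩
  have hL0 : 0 < L := by omega
  have hLr1 : (1 : ℝ) ≤ (L : ℝ) := by exact_mod_cast (show 1 ≤ L by omega)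
  have hLr0 : (0 : ℝ) < (L : ℝ) := by linarith
  -- the six inputs
  obtain ⟨δ₀, C₀, hδ₀, hC₀, H0⟩ := hasMaj_twoGridDefect (d := d) hLodd hL2 ha (γ := 1 / 2) (by norm_num) (by norm_num)
  obtain ⟨δ₁, C₁, hδ₁, hC₁, H1⟩ := hasMaj_outputSwap (d := d) hL ha
  obtain ⟨δ₂, CH, hδ₂, hCH, H2⟩ := hasMaj_holderSteps_pair (d := d) hL ha (α := 1 / 2) (by norm_num) (by norm_num)
  obtain ⟨δ₃, C₂, hδ₃, hC₂, H3⟩ := hasMaj_inv_smul_gradStep (d := d) hL ha (α := 1 / 2) (by norm_num) (by norm_num)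
  obtain ⟨δ₄, C₃, hδ₄, hC₃, H4⟩ := hasMaj_gradOutputSwap (d := d) hL ha (α := 1 / 2) (by norm_num) (by norm_num)
  obtain ⟨δ₅, Cg, Cα, Cε, Cαε, hδ₅, hCg, H5⟩ := ineq110_114_pair (d := d) hL ha
  -- the common rate and the constant
  set δ : ℝ := min (min (min δ₀ δ₁) (min δ₂ δ₃)) (min δ₄ δ₅) with hδdef
  have hδpos : 0 < δ := lt_min (lt_min (lt_min hδ₀ hδ₁) (lt_min hδ₂ hδ₃)) (lt_min hδ₄ hδ₅)
  have hδle₀ : δ ≤ δ₀ := (min_le_left _ _).trans ((min_le_left _ _).trans (min_le_left _ _))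
  have hδle₁ : δ ≤ δ₁ := (min_le_left _ _).trans ((min_le_left _ _).trans (min_le_right _ _))
  have hδle₂ : δ ≤ δ₂ := (min_le_left _ _).trans ((min_le_right _ _).trans (min_le_left _ _))
  have hδle₃ : δ ≤ δ₃ := (min_le_left _ _).trans ((min_le_right _ _).trans (min_le_right _ _))
  have hδle₄ : δ ≤ δ₄ := (min_le_right _ _).trans (min_le_left _ _)
  have hδle₅ : δ ≤ δ₅ := (min_le_right _ _).trans (min_le_right _ _)
  set Cbig : ℝ := 2 * Real.exp δ * (C₀ + C₁) + CH * (1 + Real.exp δ ^ (2 * d + 1)) * L + Real.exp δ ^ (2 * d + 2) * C₂ + C₃ with hCbig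
  have hCbig0 : 0 ≤ Cbig := by positivity
  refine ⟨δ, Cbig + 2 * Cg * Real.exp δ₅ * L + 1, hδpos, by positivity, fun mT k m hk hL' ν => ?_⟩
  -- per index
  have hn1 : 1 ≤ L ^ k := Nat.one_le_pow _ _ hL0
  have hn0 : (0 : ℝ) < ((L ^ k : ℕ) : ℝ) := by exact_mod_cast hn1
  have hnr1 : (1 : ℝ) ≤ ((L ^ k : ℕ) : ℝ) := by exact_mod_cast hn1
  have hncast : ((L ^ k : ℕ) : ℝ) = (L : ℝ) ^ k := by push_cast; ring
  have hrate0 : 0 ≤ ((L ^ k : ℕ) : ℝ) ^ (-(1 / 16 : ℝ)) := Real.rpow_nonneg hn0.le _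
  have hE : ∀ y y' : Tor (MP (paramsOf d L mT k hL)), 0 ≤ Real.exp (-(δ * tdistT (MP (paramsOf d L mT k hL)) y y')) := fun _ _ => Real.exp_nonneg _
  by_cases hk16 : 16 ≤ k
  · -- the interpolation, `t = ⌊k/8⌋ ≥ 2`, `r = L^m · L^{k−t}`
    set t : ℕ := k / 8 with ht
    have ht2 : 2 ≤ t := by omega
    have htk : t ≤ k := Nat.div_le_self k 8
    have h8t : 8 * t ≤ k := Nat.mul_div_le k 8
    have hk8t : k ≤ 8 * t + 7 := by omega
    have hLt4 : 4 ≤ L ^ t := le_trans (by nlinarith : 4 ≤ L ^ 2) (Nat.pow_le_pow_right hL0 ht2)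
    set r : ℕ := L ^ m * L ^ (k - t) with hr
    have hkt : L ^ (k - t) * L ^ t = L ^ k := by rw [← pow_add, Nat.sub_add_cancel htk]
    have hr1 : 1 ≤ r := Nat.one_le_iff_ne_zero.mpr (Nat.mul_ne_zero (pow_ne_zero m (by omega)) (pow_ne_zero _ (by omega)))
    have hr4 : 4 * r ≤ L ^ m * L ^ k := by
      calc 4 * r = L ^ m * (L ^ (k - t) * 4) := by rw [hr]; ring
        _ ≤ L ^ m * (L ^ (k - t) * L ^ t) := Nat.mul_le_mul_left _ (Nat.mul_le_mul_left _ hLt4)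
        _ = L ^ m * L ^ k := by rw [hkt]
    have hr0 : (0 : ℝ) < (r : ℝ) := by exact_mod_cast hr1
    have hkt' : (L : ℝ) ^ (k - t) * (L : ℝ) ^ t = (L : ℝ) ^ k := by rw [← pow_add, Nat.sub_add_cancel htk]
    have hquo : ((L ^ m * L ^ k : ℕ) : ℝ) / r = (L : ℝ) ^ t := by
      rw [div_eq_iff hr0.ne', hr]; push_cast; rw [← hkt']; ring
    have hquo' : (r : ℝ) / ((L ^ m * L ^ k : ℕ) : ℝ) = ((L : ℝ) ^ t)⁻¹ := by
      rw [← hquo, inv_div]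
    -- the core estimate at the common rate
    have hcore := hasMaj_entry1_core (MP (paramsOf d L mT k hL)) k m a ν hδpos.le
      (mul_nonneg hC₀.le (Real.rpow_nonneg hn0.le _)) (mul_nonneg hC₁.le (inv_nonneg.mpr hn0.le)) (mul_nonneg hC₂.le (Real.rpow_nonneg hn0.le _))
      hCH.le (by norm_num : (0 : ℝ) ≤ 1 / 2) hr1 hr4
      (hasMaj_rate_mono (mul_nonneg hC₀.le (Real.rpow_nonneg hn0.le _)) hδle₀ (H0 mT k m hk hL))
      (hasMaj_rate_mono (mul_nonneg hC₁.le (inv_nonneg.mpr hn0.le)) hδle₁ (H1 mT k m hk))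
      (fun j hj => hasMaj_rate_mono (mul_nonneg hCH.le (Real.rpow_nonneg (div_nonneg (Nat.cast_nonneg j) (Nat.cast_nonneg _)) _)) hδle₂ ((H2 mT k m hk ν ν j).2 hj))
      (fun q hq => hasMaj_rate_mono (mul_nonneg hCH.le (Real.rpow_nonneg (div_nonneg (Nat.cast_nonneg q) (Nat.cast_nonneg _)) _)) hδle₂ ((H2 mT k m hk ν ν q).1 hq))
      (hasMaj_rate_mono (mul_nonneg hC₂.le (Real.rpow_nonneg hn0.le _)) hδle₃ (H3 mT k hk ν ν))
      (hasMaj_rate_mono (A := C₃ * ((L ^ k : ℕ) : ℝ) ^ (-(1 / 2 : ℝ))) (mul_nonneg hC₃.le (Real.rpow_nonneg hn0.le _)) hδle₄ (H4 mT k m hk ν ν))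
    refine hcore.mono fun y y' => mul_le_mul_of_nonneg_right ?_ (hE y y')
    rw [hquo, hquo']
    -- the four rate comparisons
    have hx : (L : ℝ) ^ t * ((L ^ k : ℕ) : ℝ) ^ (-(1 / 4 : ℝ)) ≤ ((L ^ k : ℕ) : ℝ) ^ (-(1 / 16 : ℝ)) := by
      rw [hncast]; exact (pow_mul_rpow_le_of_le hLr1 h8t).trans (Real.rpow_le_rpow_of_exponent_le (one_le_pow₀ hLr1) (by norm_num))
    have hx1 : (L : ℝ) ^ t * ((L ^ k : ℕ) : ℝ)⁻¹ ≤ ((L ^ k : ℕ) : ℝ) ^ (-(1 / 16 : ℝ)) := by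
      refine le_trans (mul_le_mul_of_nonneg_left ?_ (pow_nonneg hLr0.le _)) hx
      rw [← Real.rpow_neg_one]
      exact Real.rpow_le_rpow_of_exponent_le hnr1 (by norm_num)
    have hy : (((L : ℝ) ^ t)⁻¹) ^ (1 / 2 : ℝ) ≤ (L : ℝ) * ((L ^ k : ℕ) : ℝ) ^ (-(1 / 16 : ℝ)) := by
      rw [hncast]; exact inv_pow_rpow_half_le hLr1 hk8t
    have hz : ((L ^ k : ℕ) : ℝ) ^ (-(1 / 2 : ℝ)) ≤ ((L ^ k : ℕ) : ℝ) ^ (-(1 / 16 : ℝ)) := Real.rpow_le_rpow_of_exponent_le hnr1 (by norm_num)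
    have hw : (1 / 2 : ℝ) = 1 / 2 := rfl
    -- assemble
    have he0 : 0 ≤ Real.exp δ := Real.exp_nonneg _
    have hterm1 : 2 * Real.exp δ * (C₀ * ((L ^ k : ℕ) : ℝ) ^ (-(1 / 2 / 2 : ℝ)) + C₁ * ((L ^ k : ℕ) : ℝ)⁻¹) * (L : ℝ) ^ t
        ≤ 2 * Real.exp δ * (C₀ + C₁) * ((L ^ k : ℕ) : ℝ) ^ (-(1 / 16 : ℝ)) := by
      have e : (-(1 / 2 / 2 : ℝ)) = -(1 / 4 : ℝ) := by norm_num
      rw [e]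
      have h1 : C₀ * ((L ^ k : ℕ) : ℝ) ^ (-(1 / 4 : ℝ)) * (L : ℝ) ^ t ≤ C₀ * ((L ^ k : ℕ) : ℝ) ^ (-(1 / 16 : ℝ)) := by
        calc C₀ * ((L ^ k : ℕ) : ℝ) ^ (-(1 / 4 : ℝ)) * (L : ℝ) ^ t = C₀ * ((L : ℝ) ^ t * ((L ^ k : ℕ) : ℝ) ^ (-(1 / 4 : ℝ))) := by ring
          _ ≤ C₀ * ((L ^ k : ℕ) : ℝ) ^ (-(1 / 16 : ℝ)) := mul_le_mul_of_nonneg_left hx hC₀.le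
      have h2 : C₁ * ((L ^ k : ℕ) : ℝ)⁻¹ * (L : ℝ) ^ t ≤ C₁ * ((L ^ k : ℕ) : ℝ) ^ (-(1 / 16 : ℝ)) := by
        calc C₁ * ((L ^ k : ℕ) : ℝ)⁻¹ * (L : ℝ) ^ t = C₁ * ((L : ℝ) ^ t * ((L ^ k : ℕ) : ℝ)⁻¹) := by ring
          _ ≤ C₁ * ((L ^ k : ℕ) : ℝ) ^ (-(1 / 16 : ℝ)) := mul_le_mul_of_nonneg_left hx1 hC₁.le
      calc 2 * Real.exp δ * (C₀ * ((L ^ k : ℕ) : ℝ) ^ (-(1 / 4 : ℝ)) + C₁ * ((L ^ k : ℕ) : ℝ)⁻¹) * (L : ℝ) ^ t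
          = 2 * Real.exp δ * (C₀ * ((L ^ k : ℕ) : ℝ) ^ (-(1 / 4 : ℝ)) * (L : ℝ) ^ t + C₁ * ((L ^ k : ℕ) : ℝ)⁻¹ * (L : ℝ) ^ t) := by ring
        _ ≤ 2 * Real.exp δ * (C₀ * ((L ^ k : ℕ) : ℝ) ^ (-(1 / 16 : ℝ)) + C₁ * ((L ^ k : ℕ) : ℝ) ^ (-(1 / 16 : ℝ))) :=
            mul_le_mul_of_nonneg_left (add_le_add h1 h2) (mul_nonneg zero_le_two he0)
        _ = 2 * Real.exp δ * (C₀ + C₁) * ((L ^ k : ℕ) : ℝ) ^ (-(1 / 16 : ℝ)) := by ring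
    have hterm2 : CH * (1 + Real.exp δ ^ (2 * d + 1)) * (((L : ℝ) ^ t)⁻¹) ^ (1 / 2 : ℝ) ≤ CH * (1 + Real.exp δ ^ (2 * d + 1)) * L * ((L ^ k : ℕ) : ℝ) ^ (-(1 / 16 : ℝ)) := by
      have : 0 ≤ CH * (1 + Real.exp δ ^ (2 * d + 1)) := by positivity
      calc CH * (1 + Real.exp δ ^ (2 * d + 1)) * (((L : ℝ) ^ t)⁻¹) ^ (1 / 2 : ℝ) ≤ CH * (1 + Real.exp δ ^ (2 * d + 1)) * ((L : ℝ) * ((L ^ k : ℕ) : ℝ) ^ (-(1 / 16 : ℝ))) :=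
            mul_le_mul_of_nonneg_left hy this
        _ = _ := by ring
    have hterm3 : Real.exp δ ^ (2 * d + 2) * (C₂ * ((L ^ k : ℕ) : ℝ) ^ (-(1 / 2 : ℝ))) ≤ Real.exp δ ^ (2 * d + 2) * C₂ * ((L ^ k : ℕ) : ℝ) ^ (-(1 / 16 : ℝ)) := by
      calc Real.exp δ ^ (2 * d + 2) * (C₂ * ((L ^ k : ℕ) : ℝ) ^ (-(1 / 2 : ℝ))) = Real.exp δ ^ (2 * d + 2) * C₂ * ((L ^ k : ℕ) : ℝ) ^ (-(1 / 2 : ℝ)) := by ring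
        _ ≤ _ := mul_le_mul_of_nonneg_left hz (by positivity)
    have hterm4 : C₃ * ((L ^ k : ℕ) : ℝ) ^ (-(1 / 2 : ℝ)) ≤ C₃ * ((L ^ k : ℕ) : ℝ) ^ (-(1 / 16 : ℝ)) := mul_le_mul_of_nonneg_left hz hC₃.le
    have hle : Cbig ≤ Cbig + 2 * Cg * Real.exp δ₅ * L + 1 := by
      have : 0 ≤ 2 * Cg * Real.exp δ₅ * L := by positivity
      linarith
    calc 2 * Real.exp δ * (C₀ * ((L ^ k : ℕ) : ℝ) ^ (-(1 / 2 / 2 : ℝ)) + C₁ * ((L ^ k : ℕ) : ℝ)⁻¹) * (L : ℝ) ^ t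
          + CH * (1 + Real.exp δ ^ (2 * d + 1)) * (((L : ℝ) ^ t)⁻¹) ^ (1 / 2 : ℝ) + Real.exp δ ^ (2 * d + 2) * (C₂ * ((L ^ k : ℕ) : ℝ) ^ (-(1 / 2 : ℝ)))
          + C₃ * ((L ^ k : ℕ) : ℝ) ^ (-(1 / 2 : ℝ))
        ≤ 2 * Real.exp δ * (C₀ + C₁) * ((L ^ k : ℕ) : ℝ) ^ (-(1 / 16 : ℝ)) + CH * (1 + Real.exp δ ^ (2 * d + 1)) * L * ((L ^ k : ℕ) : ℝ) ^ (-(1 / 16 : ℝ))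
          + Real.exp δ ^ (2 * d + 2) * C₂ * ((L ^ k : ℕ) : ℝ) ^ (-(1 / 16 : ℝ)) + C₃ * ((L ^ k : ℕ) : ℝ) ^ (-(1 / 16 : ℝ)) :=
          add_le_add (add_le_add (add_le_add hterm1 hterm2) hterm3) hterm4
      _ = Cbig * ((L ^ k : ℕ) : ℝ) ^ (-(1 / 16 : ℝ)) := by rw [hCbig]; ring
      _ ≤ (Cbig + 2 * Cg * Real.exp δ₅ * L + 1) * ((L ^ k : ℕ) : ℝ) ^ (-(1 / 16 : ℝ)) := mul_le_mul_of_nonneg_right hle hrate0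
  · -- `k < 16`: the a-priori bound, `(L^k)^{−1/16} ≥ L⁻¹`
    have hk15 : k ≤ 15 := by omega
    have hap := hasMaj_entry1_apriori (L := L) (MP (paramsOf d L mT k hL)) k m a ν hCg.le hδ₅.le (H5 mT k m hk).1 (H5 mT k m hk).2
    refine (hasMaj_rate_mono (by positivity) hδle₅ hap).mono fun y y' => mul_le_mul_of_nonneg_right ?_ (hE y y')
    -- `2·Cg·e^{δ₅} ≤ (2 Cg e^{δ₅} L) · (L^k)^{−1/16}` since `L · (L^k)^{−1/16} ≥ 1` for `k ≤ 15`
    have hpow : (1 : ℝ) ≤ (L : ℝ) * ((L ^ k : ℕ) : ℝ) ^ (-(1 / 16 : ℝ)) := by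
      rw [hncast, ← Real.rpow_natCast (L : ℝ) k, ← Real.rpow_mul hLr0.le]
      have e : (L : ℝ) * (L : ℝ) ^ ((k : ℝ) * -(1 / 16 : ℝ)) = (L : ℝ) ^ (1 + (k : ℝ) * -(1 / 16 : ℝ)) := by
        rw [Real.rpow_add hLr0, Real.rpow_one]
      rw [e]
      have hk15' : (k : ℝ) ≤ 15 := by exact_mod_cast hk15
      exact Real.one_le_rpow hLr1 (by nlinarith)
    have h2 : 2 * Cg * Real.exp δ₅ ≤ 2 * Cg * Real.exp δ₅ * L * ((L ^ k : ℕ) : ℝ) ^ (-(1 / 16 : ℝ)) := by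
      have h0 : 0 ≤ 2 * Cg * Real.exp δ₅ := by positivity
      calc 2 * Cg * Real.exp δ₅ = 2 * Cg * Real.exp δ₅ * 1 := by ring
        _ ≤ 2 * Cg * Real.exp δ₅ * ((L : ℝ) * ((L ^ k : ℕ) : ℝ) ^ (-(1 / 16 : ℝ))) := mul_le_mul_of_nonneg_left hpow h0
        _ = _ := by ring
    have h3 : 2 * Cg * Real.exp δ₅ * L * ((L ^ k : ℕ) : ℝ) ^ (-(1 / 16 : ℝ)) ≤ (Cbig + 2 * Cg * Real.exp δ₅ * L + 1) * ((L ^ k : ℕ) : ℝ) ^ (-(1 / 16 : ℝ)) :=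
      mul_le_mul_of_nonneg_right (by linarith) hrate0
    exact h2.trans h3

end Family


end Summit.QuantumFields.YangMills.BalabanUVNodes.N15.TwoGrid
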